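import Summits.HodgeConjecture.HodgeConjecture.Theorems.Ring2MotivConiveauThreeOne
import Summits.HodgeConjecture.HodgeConjecture.Theorems.Ring2HabitatWeilComponentsRefereedFourfolds
import HarnessLib

/-!
# Ring 2 · motiv (generation 23, part 2) — the general Hodge conjecture for the Weil Hodge structure of EVERY abelian
fourfold with `ℚ(√-d) ⊂ End⁰`, at its expected coniveau, from one printed sixfold theorem

HONEST FRAMING (cell `pub-hodge-ring2`, seat `motiv`, verbatim): research route conditional on HC_CM; not a
corollary; Q11.4-sentence-2 already refuted in dim ≥ 3. `HC_CM` (:= `Theses.RankFourFaces.CMAbelianHodge`) occurs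
NOWHERE in this file: every theorem below is either unconditional or takes ONE printed sixfold theorem as a
NAMED-FACT hypothesis (`(hK : Koike2004_…)` refereed, `(hS : Schoen1998_…)` refereed, `(hM : Markman2025_…)`
UNREFEREED). No named fact is introduced or discharged; nothing derived by the cell is entered as a fact.

THE STATEMENT. Let `Y` be an abelian fourfold and `φ ∈ End(Y)` with `φ² = -d`, `d ≥ 1` (so `K = ℚ(√-d) ⊂ End⁰(Y)`),
and let `m ∈ {0,…,4}` be the multiplicity of the eigenvalue `i√d` of `φ^*` on `H^{1,0}(Y)` (`eigenMultiplicity`; the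
two multiplicities add up to `dim Y = 4`, `eigenMultiplicity_add_eigenMultiplicity_neg_eq_dim`). The complexified Weil
plane `W := weilClassesOf Y φ 2 d = ⋀⁴_σ ⊕ ⋀⁴_σ̄ ⊆ H⁴(Y(ℂ); ℂ)` has Hodge types `{(m, 4-m), (4-m, m)}`, so the general
Hodge conjecture (as corrected by Grothendieck) predicts `W ⊆ N^{c(m)} H⁴(Y(ℂ); ℂ)` with `c(m) = min (m, 4-m)`:

* `m ∈ {0, 4}`: `c = 0`, `N⁰ = H⁴` — NO CONTENT (`supportedClasses_zero`);
* `m = 2` (Weil type `(2,2)`): `c = 2`, `N² H⁴ = algebraicClasses` — the usual Hodge conjecture for the Weil classes of a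
  Weil-type fourfold of `K`, EVERY discriminant: in the tree this is the AbelianAll seat's PROVED descent
  `stub_descend 2 d` (partner CM surface + Schoen's transfer), served sliced by the habitat seat as
  `Ring2.Habitat.weilAlgebraicAll_two_of_floorSlice` (COUNT ONCE — theirs), composed here with motiv's submodule
  bridge `weilClassesOf_le_algebraicClasses_of_weilAlgebraicFor` (part 1, §2);
* `m ∈ {1, 3}` (signature `(3,1)`): `c = 1` — part 1 of this generation,
  `weilClassesOf_fourfold31_le_supportedClasses_one_of_{koike, schoen1998, markman}` (inside it, counted once and
  theirs: `isSplitWeilType_odd_prod_curve` p205880, `weilAlgebraicFor_three_fourfold_prod_curve_sq_of_*` p206442; the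
  coniveau transfer of generation 21 is Grothendieck 1969 / Abdulali 1997 run on the carriers).

WHAT THIS FILE PROVES (kernel, 0 sorry; glue only — every load-bearing input is cited by name above):
`weilClassesOf_fourfold_le_supportedClasses_min_of_{koike, schoen1998, markman}`:
`weilClassesOf Y φ 2 d ≤ supportedClasses Y.X 4 (min m (4 - m))` for EVERY abelian fourfold `Y` with `φ² = -d` —
`d = 1` granted ONLY Koike 2004 (refereed), `d = 3` granted ONLY Schoen 1998 (refereed), any `d ≥ 1` granted ONLY
Markman's F2 (UNREFEREED) — i.e. the general Hodge conjecture for the Weil Hodge structure `W_K(Y)` of every abelian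
fourfold with `K ⊂ End⁰`, with no signature, discriminant, hyperbolicity, polarisation or Hodge-group hypothesis; plus
the `(2,2)` slice in submodule form `weilClassesOf_fourfold22_le_algebraicClasses_of_{weilAlgebraicAll, koike,
schoen1998, markman}` and the generic assembly `weilClassesOf_fourfold_le_supportedClasses_min`.

PRINT STATUS (numbers, not adjectives). `m = 2`: in print for `d ∈ {1, 3}`, all discriminants (Schoen 1988 Thm. 3.0
with the 1998 addendum §10; van Geemen 1994 Thm. 6.12 and Koike 2004 Rem. 2.1 / Cor. 2.1; Abdulali 2016 App. A (b));
general `K`: Markman Cor. 1.6.1 (preprint). `m ∈ {1, 3}`: `d = 1` Schoen 1989 §6 (Abdulali 2016 §8.2 case 1); `d = 3`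
and general `K`: no proof recorded in the surveyed print literature (Abdulali 2016 §8.2, App. A; see part 1).
`m ∈ {0, 4}`: trivial. So the one-line statement "GHC holds for `W_K(Y)` of every abelian fourfold with
`ℚ(i) ⊂ End⁰` [resp. `ℚ(√-3) ⊂ End⁰`]" is, for `ℚ(i)`, a kernel COMPOSITION of printed theorems (second proofs on the
carriers), and for `ℚ(√-3)` new in its `(3,1)` clause only. PROVENANCE: compositions of the cited printed steps and
the named tree theorems, not numbered results of the sources.

## References
* [GrothendieckTopology1969] A. Grothendieck, Topology 8 (1969), p. 301. [Abdulali2016TateTwists] S. Abdulali,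
  LMS LN 427 (2016), Prop. 3.2, §8.2 (p. 298), Appendix A.
* [Koike2004WeilHodge] K. Koike, Canad. Math. Bull. 47 (2004), Thm. 2.1, Cor. 2.1, Rem. 2.1.
  [Schoen1998HodgeWeilAddendum] C. Schoen, Compositio Math. 114 (1998), §10 (Proposition, pp. 332–333), §§11–13.
  [Schoen1988HodgeWeil] Compositio Math. 65 (1988), Thm. 3.0.
* [Markman2025SecantWeil] E. Markman, arXiv:2502.03415, Thm. 1.5.1, Cor. 1.6.1 (UNREFEREED).
* [vanGeemen1994HodgeAV] B. van Geemen, LNM 1594 (1994), Lemma 5.2, Thm. 6.12.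
  [MoonenZarhin1998WeilClasses] §1 (the multiplicities `n_σ`).
-/

set_option linter.dupNamespace false

noncomputable section

open CategoryTheory

namespace Summit.HodgeConjecture.HodgeConjecture.Ring2.Motiv

open Literature.AlgebraicGeometry Literature.AlgebraicGeometry.Motives
open Literature.AlgebraicGeometry.HodgeTheory
open Literature.AlgebraicTopology.SingularHomology
open Summit.HodgeConjecture.HodgeConjecture.Ring2.Hypotheses
open Summit.HodgeConjecture.HodgeConjecture.Ring2.Atlas
open Summit.HodgeConjecture.HodgeConjecture.Cruxes.HodgeAbelianVarieties.EStepSecantInduction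
  (WeilAlgebraicFor WeilAlgebraicAll)
open Summit.HodgeConjecture.HodgeConjecture.Ring2.Habitat (weilAlgebraicAll_two_of_floorSlice)

variable {Y : AbelianVariety ℂ} {d : ℕ} {φ : Y ⟶ Y}

/-! ## §1 The `(2,2)` slice in submodule form -/

section TwoTwo

/-- **Weil type `(2,2)`: the complexified Weil plane of `Y` consists of algebraic classes, granted the fourfold slice
`WeilAlgebraicAll 2 d`** (pointwise ⇒ submodule: part 1 §2, with `isWeilType_of_eigenMultiplicity_eq`).
[cite: vanGeemen1994HodgeAV, Lemma 5.2 (1)] [cite: MoonenZarhin1998WeilClasses, §1] -/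
theorem weilClassesOf_fourfold22_le_algebraicClasses_of_weilAlgebraicAll (h : WeilAlgebraicAll 2 d) (hd : 0 < d)
    (hY : Y.dim = 4) (hφ : φ ≫ φ = -(d • 𝟙 Y))
    (h22 : eigenMultiplicity Y φ (Complex.I * (Real.sqrt d : ℂ)) = 2) :
    weilClassesOf Y φ 2 d ≤ algebraicClasses Y.X 2 :=
  have hY' : Y.dim = 2 * 2 := by omega
  weilClassesOf_le_algebraicClasses_of_weilAlgebraicFor
    (isWeilType_of_eigenMultiplicity_eq two_pos hd hY' hφ h22) (h Y φ hY' hφ)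

/-- **`(2,2)` over `ℚ(i)`, every discriminant, from Koike 2004 ALONE** (refereed; the descent sixfolds ⇒ fourfolds
is the tree's proved `stub_descend 2 1`, served as `Ring2.Habitat.weilAlgebraicAll_two_of_floorSlice` — count once).
[cite: Koike2004WeilHodge, Cor. 2.1 and Rem. 2.1] [cite: Schoen1998HodgeWeilAddendum, §10]
[cite: vanGeemen1994HodgeAV, Thm. 6.12] -/
theorem weilClassesOf_fourfold22_le_algebraicClasses_of_koike
    (hK : Koike2004_weilClasses_algebraic_hyperbolicSixfold_one) (hY : Y.dim = 4)
    (hφ : φ ≫ φ = -((1 : ℕ) • 𝟙 Y)) (h22 : eigenMultiplicity Y φ (Complex.I * (Real.sqrt (1 : ℕ) : ℂ)) = 2) :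
    weilClassesOf Y φ 2 1 ≤ algebraicClasses Y.X 2 :=
  weilClassesOf_fourfold22_le_algebraicClasses_of_weilAlgebraicAll
    (weilAlgebraicAll_two_of_floorSlice one_pos hK) one_pos hY hφ h22

/-- **`(2,2)` over `ℚ(√-3)`, every discriminant, from Schoen 1998 ALONE** (refereed; in print Schoen 1988 Thm. 3.0
with the 1998 addendum). [cite: Schoen1998HodgeWeilAddendum, §10 and Theorem p. 329]
[cite: Schoen1988HodgeWeil, Thm. 3.0] -/
theorem weilClassesOf_fourfold22_le_algebraicClasses_of_schoen1998
    (hS : Schoen1998_weilClasses_algebraic_hyperbolicSixfold_three) (hY : Y.dim = 4)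
    (hφ : φ ≫ φ = -((3 : ℕ) • 𝟙 Y)) (h22 : eigenMultiplicity Y φ (Complex.I * (Real.sqrt (3 : ℕ) : ℂ)) = 2) :
    weilClassesOf Y φ 2 3 ≤ algebraicClasses Y.X 2 :=
  weilClassesOf_fourfold22_le_algebraicClasses_of_weilAlgebraicAll
    (weilAlgebraicAll_two_of_floorSlice (by norm_num) hS) (by norm_num) hY hφ h22

/-- **`(2,2)` over any `K = ℚ(√-d)`, every discriminant, from Markman's F2 ALONE** (UNREFEREED preprint).
[cite: Markman2025SecantWeil, Thm. 1.5.1 and Cor. 1.6.1 (preprint, unrefereed)] -/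
theorem weilClassesOf_fourfold22_le_algebraicClasses_of_markman
    (hM : Markman2025_weilClasses_algebraic_hyperbolicSixfold) (hY : Y.dim = 4) (hd : 0 < d)
    (hφ : φ ≫ φ = -(d • 𝟙 Y)) (h22 : eigenMultiplicity Y φ (Complex.I * (Real.sqrt d : ℂ)) = 2) :
    weilClassesOf Y φ 2 d ≤ algebraicClasses Y.X 2 :=
  weilClassesOf_fourfold22_le_algebraicClasses_of_weilAlgebraicAll
    (weilAlgebraicAll_two_of_floorSlice hd (hM d hd)) hd hY hφ h22

end TwoTwo

/-! ## §2 Assembly over the multiplicity `m ∈ {0,…,4}` -/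

section Assembly

/-- Re-indexing the support level along a numeral identity. [folklore] -/
private theorem le_supportedClasses_of_eq {X : SchemeOver ℂ} {i s : ℕ} {W : Submodule ℂ (complexBetti X i)}
    (hle : W ≤ supportedClasses X i s) {r : ℕ} (h : r = s) : W ≤ supportedClasses X i r :=
  h ▸ hle

/-- `N⁰ H⁴ = H⁴`: the Weil plane of a fourfold is supported in codimension `0` (no content).
[cite: GrothendieckTopology1969, §1] -/
private theorem weilClassesOf_fourfold_le_supportedClasses_zero :
    weilClassesOf Y φ 2 d ≤ supportedClasses Y.X 4 0 := by
  rw [supportedClasses_zero]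
  exact le_top

/-- **GHC for `W_K(Y)` at the expected coniveau `min (m, 4-m)`, assembled** from the `(2,2)` slice `WeilAlgebraicAll 2 d`
and the signature-`(3,1)` coniveau-one statement; `m ∈ {0, 4}` is free (`N⁰ = H⁴`).
[cite: GrothendieckTopology1969, p. 301] [cite: MoonenZarhin1998WeilClasses, §1] -/
theorem weilClassesOf_fourfold_le_supportedClasses_min (hd : 0 < d) (hY : Y.dim = 4) (hφ : φ ≫ φ = -(d • 𝟙 Y))
    (h2 : WeilAlgebraicAll 2 d)
    (h31 : (eigenMultiplicity Y φ (Complex.I * (Real.sqrt d : ℂ)) = 3 ∨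
      eigenMultiplicity Y φ (Complex.I * (Real.sqrt d : ℂ)) = 1) →
      weilClassesOf Y φ 2 d ≤ supportedClasses Y.X 4 1) :
    weilClassesOf Y φ 2 d ≤ supportedClasses Y.X 4
      (min (eigenMultiplicity Y φ (Complex.I * (Real.sqrt d : ℂ)))
        (4 - eigenMultiplicity Y φ (Complex.I * (Real.sqrt d : ℂ)))) := by
  have h22 := weilClassesOf_fourfold22_le_algebraicClasses_of_weilAlgebraicAll h2 hd hY hφ
  have h := eigenMultiplicity_add_eigenMultiplicity_neg_eq_dim Y φ hd hφ
  rw [hY] at h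
  generalize hm : eigenMultiplicity Y φ (Complex.I * (Real.sqrt d : ℂ)) = m at h h22 h31 ⊢
  rcases (by omega : m = 0 ∨ m = 1 ∨ m = 2 ∨ m = 3 ∨ m = 4) with rfl | rfl | rfl | rfl | rfl
  · exact le_supportedClasses_of_eq weilClassesOf_fourfold_le_supportedClasses_zero (by decide)
  · exact le_supportedClasses_of_eq (h31 (Or.inr rfl)) (by decide)
  · exact le_supportedClasses_of_eq (h22 rfl) (by decide)
  · exact le_supportedClasses_of_eq (h31 (Or.inl rfl)) (by decide)
  · exact le_supportedClasses_of_eq weilClassesOf_fourfold_le_supportedClasses_zero (by decide)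

end Assembly

/-! ## §3 Headline: every abelian fourfold with `K ⊂ End⁰`, from one printed sixfold theorem -/

section Headline

/-- **GHC for the Weil Hodge structure of EVERY abelian fourfold with `ℚ(i) ⊂ End⁰`, from Koike 2004 ALONE**
(refereed): `weilClassesOf Y φ 2 1 ⊆ N^{min(m,4-m)} H⁴(Y(ℂ); ℂ)`, `m` the multiplicity of `i` on `H^{1,0}(Y)`. In print:
`m = 2` van Geemen / Koike, `m ∈ {1,3}` Schoen 1989 §6 — a kernel composition, second proofs on the carriers.
[cite: Koike2004WeilHodge, Thm. 2.1, Cor. 2.1, Rem. 2.1] [cite: Abdulali2016TateTwists, §8.2 and App. A]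
[cite: GrothendieckTopology1969, p. 301] -/
theorem weilClassesOf_fourfold_le_supportedClasses_min_of_koike
    (hK : Koike2004_weilClasses_algebraic_hyperbolicSixfold_one) (hY : Y.dim = 4)
    (hφ : φ ≫ φ = -((1 : ℕ) • 𝟙 Y)) :
    weilClassesOf Y φ 2 1 ≤ supportedClasses Y.X 4
      (min (eigenMultiplicity Y φ (Complex.I * (Real.sqrt (1 : ℕ) : ℂ)))
        (4 - eigenMultiplicity Y φ (Complex.I * (Real.sqrt (1 : ℕ) : ℂ)))) :=
  weilClassesOf_fourfold_le_supportedClasses_min one_pos hY hφ (weilAlgebraicAll_two_of_floorSlice one_pos hK)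
    (weilClassesOf_fourfold31_le_supportedClasses_one_of_koike hK hY hφ)

/-- **GHC for the Weil Hodge structure of EVERY abelian fourfold with `ℚ(√-3) ⊂ End⁰`, from Schoen 1998 ALONE**
(refereed): `weilClassesOf Y φ 2 3 ⊆ N^{min(m,4-m)} H⁴(Y(ℂ); ℂ)`. In print: `m = 2` Schoen 1988/1998 (all
discriminants); `m ∈ {1,3}`: no proof recorded in the surveyed print literature (Abdulali 2016 §8.2, App. A) — decided
in part 1 from the same single refereed input. [cite: Schoen1998HodgeWeilAddendum, §§10–13]
[cite: Schoen1988HodgeWeil, Thm. 3.0] [cite: Abdulali2016TateTwists, §8.2 and App. A]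
[cite: GrothendieckTopology1969, p. 301] -/
theorem weilClassesOf_fourfold_le_supportedClasses_min_of_schoen1998
    (hS : Schoen1998_weilClasses_algebraic_hyperbolicSixfold_three) (hY : Y.dim = 4)
    (hφ : φ ≫ φ = -((3 : ℕ) • 𝟙 Y)) :
    weilClassesOf Y φ 2 3 ≤ supportedClasses Y.X 4
      (min (eigenMultiplicity Y φ (Complex.I * (Real.sqrt (3 : ℕ) : ℂ)))
        (4 - eigenMultiplicity Y φ (Complex.I * (Real.sqrt (3 : ℕ) : ℂ)))) :=
  weilClassesOf_fourfold_le_supportedClasses_min (by norm_num) hY hφ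
    (weilAlgebraicAll_two_of_floorSlice (by norm_num) hS)
    (weilClassesOf_fourfold31_le_supportedClasses_one_of_schoen1998 hS hY hφ)

/-- **GHC for the Weil Hodge structure of EVERY abelian fourfold with `ℚ(√-d) ⊂ End⁰`, any `d ≥ 1`, from Markman's
F2 ALONE** (UNREFEREED preprint). [cite: Markman2025SecantWeil, Thm. 1.5.1, Cor. 1.6.1 (preprint, unrefereed)]
[cite: GrothendieckTopology1969, p. 301] -/
theorem weilClassesOf_fourfold_le_supportedClasses_min_of_markman
    (hM : Markman2025_weilClasses_algebraic_hyperbolicSixfold) (hY : Y.dim = 4) (hd : 0 < d)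
    (hφ : φ ≫ φ = -(d • 𝟙 Y)) :
    weilClassesOf Y φ 2 d ≤ supportedClasses Y.X 4
      (min (eigenMultiplicity Y φ (Complex.I * (Real.sqrt d : ℂ)))
        (4 - eigenMultiplicity Y φ (Complex.I * (Real.sqrt d : ℂ)))) :=
  weilClassesOf_fourfold_le_supportedClasses_min hd hY hφ (weilAlgebraicAll_two_of_floorSlice hd (hM d hd))
    (weilClassesOf_fourfold31_le_supportedClasses_one_of_markman hM hY hd hφ)

end Headline

end Summit.HodgeConjecture.HodgeConjecture.Ring2.Motiv

end
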